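import Summits.QuantumFields.GaugeBoot.PolynomialSchwingerDysonSeries
import Mathlib.Analysis.Calculus.MeanValue
import HarnessLib

/-!
# Polynomial Schwinger–Dyson states, II: they determine the Wilson measure (finite volume) and the DLR states (`ℤ^d`) (gauge-boot, L1 supplement)

HONEST FRAMING (cell `pub-gaugeboot`, page 1 of every file): the venture produces certified bounds
on lattice expectations at stated coupling, gauge group, dimension and torus size; NOT a mass gap,
NOT a continuum limit, NOT a string tension; NOT Yang–Mills-summit-bearing (barriers
`FixedCouplingUltralocality`, `PerturbativeInvisibility`). Structural; it certifies no number.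

## Content

Continuing `PolynomialSchwingerDysonSeries.lean` (STEP 1: `∫ h' e^{βS} dμ = 0` for polynomial `h`):

* `integral_comp_shift_mul_exp_eq` — STEP 2 (derivative route): polynomials are shift invariant and
  differentiable along the exponential shifts, so `t ↦ ∫ h(U[i ↦ e^{tX} U_i]) e^{βS(U)} dμ` has zero
  derivative everywhere (STEP 1 at every `t`, differentiation under the integral), hence is constant
  (`is_const_of_deriv_eq_zero`);
* `integral_comp_shift_mul_exp_eq_of_continuous` — STEP 3: Stone–Weierstrass density
  (`mem_closure_polyAlgebra`) upgrades the invariance of `e^{βS} dμ` to all continuous observables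
  (both sides are Lipschitz functionals on `C(ι → G, ℝ)`);
* `integral_comp_shift_eq_of_polySD` — STEP 4: the Haar-shift identity along the subgroup;
* ★★ `IsPolySchwingerDysonState.isSchwingerDysonState`, ★★ `isPolySchwingerDysonState_iff` —
  for an exponential family exhausting `G` and polynomial local actions: POLYNOMIAL Schwinger–Dyson
  state ⇔ Schwinger–Dyson state;
* ★★★ `eq_wilsonMeasure_iff_polySD_suN` / `_uN` — `SU(N)` / `U(N)` on the torus `(ℤ/L)^d`, ANY real
  `β`: a probability measure satisfies the one-link Schwinger–Dyson identities for all POLYNOMIAL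
  observables (all links, all `X ∈ 𝔰𝔲(N)` / `𝔲(N)`) iff it is Wilson's measure;
  ★★★ `isPolySchwingerDysonState_iff_mem_ymGibbsMeasures_suN` — `SU(N)` on `ℤ^d`: iff it is a DLR
  state of the Wilson action.

What is still NOT covered: the restriction to GAUGE-INVARIANT (trace) polynomials and to finitely
many rows.

References: S. Chatterjee, arXiv:1502.07719 §3; P. Anderson, M. Kruczenski, Nucl. Phys. B 921
(2017); V. Kazakov, Z. Zheng, arXiv:2203.11360. Folklore.
-/

noncomputable section

open MeasureTheory Filter Topology NormedSpace
open scoped Matrix.Norms.Frobenius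
open Literature.MathematicalPhysics.QuantumFieldTheory (LatticeRep haarProbability)

namespace Summit.QuantumFields.GaugeBoot

section Poly

variable {ι : Type*} [DecidableEq ι] {G : Type*} [Group G] [TopologicalSpace G] [IsTopologicalGroup G]
  [CompactSpace G] [MeasurableSpace G] [BorelSpace G] [SecondCountableTopology G] [Countable ι]
  (r : LatticeRep G) {K : Type*} {k : ℝ → G} {X : Matrix (Fin r.N) (Fin r.N) ℂ} {i : ι}
  {S S' : (ι → G) → ℝ} {β : ℝ} {μ : Measure (ι → G)} [IsFiniteMeasure μ]

/-- **Step 2 (derivative route).** Under the hypotheses of Step 1 with `ρ(k t) = e^{tX}`: for every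
polynomial `h`, `t ↦ ∫ h(U[i ↦ k(t) U_i]) e^{β S(U)} dμ` is constant — polynomials are shift
invariant and differentiable along the shift, and Step 1 kills the derivative at every `t`.
[folklore] -/
theorem integral_comp_shift_mul_exp_eq (hkc : Continuous k) (hk : ∀ s t, k (s + t) = k s * k t)
    (hX : ∀ t, r.ρ (k t) = exp ((t : ℂ) • X))
    (hS : S ∈ polyFunctions (ι := ι) r) (hS'c : Continuous S')
    (hS' : ∀ U, HasDerivAt (fun t => S (Function.update U i (k t * U i))) (S' U) 0)
    (hsd : ∀ f ∈ polyFunctions (ι := ι) r, ∀ f' : (ι → G) → ℝ, Continuous f' →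
      (∀ U, HasDerivAt (fun t => f (Function.update U i (k t * U i))) (f' U) 0) →
      ∫ U, f' U ∂μ = β * ∫ U, f U * S' U ∂μ)
    {h : (ι → G) → ℝ} (hh : h ∈ polyFunctions (ι := ι) r) (t : ℝ) :
    ∫ U, h (Function.update U i (k t * U i)) * Real.exp (β * S U) ∂μ =
      ∫ U, h U * Real.exp (β * S U) ∂μ := by
  have hT := isContinuousFlow_update_mul hkc hk i
  have hSc : Continuous S := continuous_of_mem_polyFunctions r hS
  have hwc : Continuous fun U : ι → G => Real.exp (β * S U) :=
    Real.continuous_exp.comp (continuous_const.mul hSc)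
  set ψ : ℝ → ℝ := fun t => ∫ U, h (Function.update U i (k t * U i)) * Real.exp (β * S U) ∂μ with hψ
  -- zero derivative at every time
  have hderiv : ∀ t, HasDerivAt ψ 0 t := fun t => by
    have hg : (fun U => h (Function.update U i (k t * U i))) ∈ polyFunctions (ι := ι) r :=
      comp_updateMul_mem_polyFunctions r i (k t) hh
    obtain ⟨g', hg'c, hg'⟩ := exists_hasDerivAt_of_mem_polyFunctions r hk hX i hg
    have h0 : ∫ U, g' U * Real.exp (β * S U) ∂μ = 0 :=
      integral_deriv_mul_exp_eq_zero r hk hS hS'c hS' hsd hg hg'c hg'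
    have h1 : HasDerivAt (fun s => ∫ U, h (Function.update (Function.update U i (k s * U i)) i
        (k t * Function.update U i (k s * U i) i)) * Real.exp (β * S U) ∂μ) 0 0 := by
      have h1' := hasDerivAt_integral_comp_flow_mul hT μ hwc (continuous_of_mem_polyFunctions r hg)
        hg'c hg'
      rw [h0] at h1'
      exact h1'
    have h2 : (fun s => ∫ U, h (Function.update (Function.update U i (k s * U i)) i
        (k t * Function.update U i (k s * U i) i)) * Real.exp (β * S U) ∂μ) = fun s => ψ (s + t) := by
      funext s
      simp only [hψ, Function.update_idem, Function.update_self, ← mul_assoc, ← hk, add_comm]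
    rw [h2] at h1
    have h3 := HasDerivAt.comp_add_const t (-t) (f := fun s => ψ (s + t)) (f' := 0)
      (by rwa [add_neg_cancel])
    simpa only [neg_add_cancel_right] using h3
  have hconst := is_const_of_deriv_eq_zero (fun t => (hderiv t).differentiableAt)
    (fun t => (hderiv t).deriv) t 0
  have h0' : k 0 = 1 := by
    have h := hk 0 0
    rw [add_zero] at h
    exact mul_eq_left.1 h.symm
  simpa only [hψ, h0', one_mul, Function.update_eq_self] using hconst

/-- **Step 3 (density).** The invariance of Step 2 extends from polynomial to all continuous
observables (Stone–Weierstrass, `polyAlgebra_topologicalClosure`). [folklore] -/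
theorem integral_comp_shift_mul_exp_eq_of_continuous (hkc : Continuous k)
    (hk : ∀ s t, k (s + t) = k s * k t) (hX : ∀ t, r.ρ (k t) = exp ((t : ℂ) • X))
    (hS : S ∈ polyFunctions (ι := ι) r) (hS'c : Continuous S')
    (hS' : ∀ U, HasDerivAt (fun t => S (Function.update U i (k t * U i))) (S' U) 0)
    (hsd : ∀ f ∈ polyFunctions (ι := ι) r, ∀ f' : (ι → G) → ℝ, Continuous f' →
      (∀ U, HasDerivAt (fun t => f (Function.update U i (k t * U i))) (f' U) 0) →
      ∫ U, f' U ∂μ = β * ∫ U, f U * S' U ∂μ)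
    (F : (ι → G) → ℝ) (hF : Continuous F) (t : ℝ) :
    ∫ U, F (Function.update U i (k t * U i)) * Real.exp (β * S U) ∂μ =
      ∫ U, F U * Real.exp (β * S U) ∂μ := by
  have hSc : Continuous S := continuous_of_mem_polyFunctions r hS
  set w : (ι → G) → ℝ := fun U => Real.exp (β * S U) with hw
  have hwc : Continuous w := Real.continuous_exp.comp (continuous_const.mul hSc)
  have hwi : Integrable w μ := IsContinuousFlow.integrable_of_continuous_of_compactSpace μ hwc
  -- the two sides as continuous functionals on `C(ι → G, ℝ)`
  have hLip : ∀ (θ : (ι → G) → (ι → G)), Continuous θ →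
      Continuous fun K : C(ι → G, ℝ) => ∫ U, K (θ U) * w U ∂μ := fun θ hθ => by
    refine (LipschitzWith.of_dist_le_mul (K := Real.toNNReal (∫ U, |w U| ∂μ))
      (f := fun K : C(ι → G, ℝ) => ∫ U, K (θ U) * w U ∂μ) fun K₁ K₂ => ?_).continuous
    have hi : ∀ K : C(ι → G, ℝ), Integrable (fun U => K (θ U) * w U) μ := fun K =>
      IsContinuousFlow.integrable_of_continuous_of_compactSpace μ (f := fun U => K (θ U) * w U)
        ((K.continuous.comp hθ).mul hwc)
    rw [Real.dist_eq, Real.coe_toNNReal _ (integral_nonneg fun U => abs_nonneg _),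
      ← integral_sub (hi K₁) (hi K₂)]
    calc |∫ U, (K₁ (θ U) * w U - K₂ (θ U) * w U) ∂μ|
        ≤ ∫ U, |K₁ (θ U) * w U - K₂ (θ U) * w U| ∂μ := abs_integral_le_integral_abs
      _ ≤ ∫ U, |w U| * dist K₁ K₂ ∂μ := by
          refine integral_mono_of_nonneg (ae_of_all _ fun _ => abs_nonneg _) (hwi.abs.mul_const _)
            (ae_of_all _ fun U => ?_)
          have hK := (K₁ - K₂).norm_coe_le_norm (θ U)
          rw [ContinuousMap.sub_apply, Real.norm_eq_abs, ← dist_eq_norm] at hK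
          show |K₁ (θ U) * w U - K₂ (θ U) * w U| ≤ |w U| * dist K₁ K₂
          rw [← sub_mul, abs_mul, mul_comm]
          exact mul_le_mul_of_nonneg_left hK (abs_nonneg _)
      _ = (∫ U, |w U| ∂μ) * dist K₁ K₂ := integral_mul_const _ _
  have hc1 := hLip (fun U => Function.update U i (k t * U i))
    ((isContinuousFlow_update_mul hkc hk i).continuous_right t)
  have hc2 := hLip id continuous_id
  -- the set where they agree is closed and contains the dense polynomial algebra
  have hclosed : IsClosed {K : C(ι → G, ℝ) | ∫ U, K (Function.update U i (k t * U i)) * w U ∂μ =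
      ∫ U, K U * w U ∂μ} := isClosed_eq hc1 hc2
  have hsub : (polyAlgebra (ι := ι) r : Set C(ι → G, ℝ)) ⊆ {K : C(ι → G, ℝ) |
      ∫ U, K (Function.update U i (k t * U i)) * w U ∂μ = ∫ U, K U * w U ∂μ} := fun K hK =>
    integral_comp_shift_mul_exp_eq r hkc hk hX hS hS'c hS' hsd (coe_mem_polyFunctions r hK) t
  have hmem := (hclosed.closure_subset_iff.2 hsub) (mem_closure_polyAlgebra r ⟨F, hF⟩)
  exact hmem

/-- **Step 4.** The weighted invariance gives the Haar-shift identity along the subgroup: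
`∫ F(U[i ↦ k(t)U_i]) dμ = ∫ F(U) e^{-β (S(U[i ↦ k(t)⁻¹U_i]) - S(U))} dμ`. [folklore] -/
theorem integral_comp_shift_eq_of_polySD (hkc : Continuous k) (hk : ∀ s t, k (s + t) = k s * k t)
    (hX : ∀ t, r.ρ (k t) = exp ((t : ℂ) • X)) (hS : S ∈ polyFunctions (ι := ι) r)
    (hS'c : Continuous S')
    (hS' : ∀ U, HasDerivAt (fun t => S (Function.update U i (k t * U i))) (S' U) 0)
    (hsd : ∀ f ∈ polyFunctions (ι := ι) r, ∀ f' : (ι → G) → ℝ, Continuous f' →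
      (∀ U, HasDerivAt (fun t => f (Function.update U i (k t * U i))) (f' U) 0) →
      ∫ U, f' U ∂μ = β * ∫ U, f U * S' U ∂μ)
    (F : (ι → G) → ℝ) (hF : Continuous F) (t : ℝ) :
    ∫ U, F (Function.update U i (k t * U i)) ∂μ =
      ∫ U, F U * Real.exp (-(β * (S (Function.update U i ((k t)⁻¹ * U i)) - S U))) ∂μ := by
  have hT := isContinuousFlow_update_mul hkc hk i
  have hSc : Continuous S := continuous_of_mem_polyFunctions r hS
  have h1 := integral_comp_shift_mul_exp_eq_of_continuous r hkc hk hX hS hS'c hS' hsd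
    (fun U => F U * Real.exp (-(β * S (Function.update U i (k (-t) * U i)))))
    (hF.mul (Real.continuous_exp.comp (continuous_const.mul (hSc.comp (hT.continuous_right _))).neg)) t
  have hl : ∀ U : ι → G, F (Function.update U i (k t * U i)) * Real.exp (-(β * S (Function.update
      (Function.update U i (k t * U i)) i (k (-t) * Function.update U i (k t * U i) i)))) *
      Real.exp (β * S U) = F (Function.update U i (k t * U i)) := fun U => by
    have e : Function.update (Function.update U i (k t * U i)) i
        (k (-t) * Function.update U i (k t * U i) i) = U := hT.neg_comp t U
    rw [e, mul_assoc, ← Real.exp_add, neg_add_cancel, Real.exp_zero, mul_one]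
  have hr : ∀ U : ι → G, F U * Real.exp (-(β * S (Function.update U i (k (-t) * U i)))) *
      Real.exp (β * S U) = F U * Real.exp (-(β * (S (Function.update U i ((k t)⁻¹ * U i)) - S U))) :=
    fun U => by
    rw [update_oneParam_neg hk, mul_assoc, ← Real.exp_add]
    congr 2
    ring
  simpa only [hl, hr] using h1

variable {k : K → ℝ → G} {X : K → Matrix (Fin r.N) (Fin r.N) ℂ} {S : ι → (ι → G) → ℝ}

/-- ★★ **A polynomial Schwinger–Dyson probability state is a Schwinger–Dyson state** (exponential
family `ρ(k_a t) = e^{tX_a}` exhausting `G`, polynomial local actions). [folklore] -/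
theorem IsPolySchwingerDysonState.isSchwingerDysonState
    (hkc : ∀ a, Continuous (k a)) (hk : ∀ a s t, k a (s + t) = k a s * k a t)
    (hX : ∀ a t, r.ρ (k a t) = exp ((t : ℂ) • X a)) (hG : ∀ g : G, ∃ a t, k a t = g)
    (hS : ∀ i, S i ∈ polyFunctions (ι := ι) r) (hμ : IsPolySchwingerDysonState r k S β μ) :
    IsSchwingerDysonState k S β μ := by
  refine isSchwingerDysonState_of_haarShift hkc hk (fun i => continuous_of_mem_polyFunctions r (hS i))
    (fun i a => ?_) fun i g F hF => ?_
  · obtain ⟨S', hS'c, hS', -⟩ := hμ i a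
    exact ⟨S', hS'c, hS'⟩
  · obtain ⟨a, t, rfl⟩ := hG g
    obtain ⟨S', hS'c, hS', hsd⟩ := hμ i a
    exact integral_comp_shift_eq_of_polySD r (hkc a) (hk a) (hX a) (hS i) hS'c hS' hsd F hF t

/-- ★★ **Polynomial and full Schwinger–Dyson states coincide** (exponential family exhausting `G`,
polynomial local actions, finite `μ`). [folklore] -/
theorem isPolySchwingerDysonState_iff (hkc : ∀ a, Continuous (k a))
    (hk : ∀ a s t, k a (s + t) = k a s * k a t) (hX : ∀ a t, r.ρ (k a t) = exp ((t : ℂ) • X a))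
    (hG : ∀ g : G, ∃ a t, k a t = g) (hS : ∀ i, S i ∈ polyFunctions (ι := ι) r) :
    IsPolySchwingerDysonState r k S β μ ↔ IsSchwingerDysonState k S β μ :=
  ⟨fun hμ => hμ.isSchwingerDysonState r hkc hk hX hG hS, fun hμ => hμ.isPolySchwingerDysonState r⟩

end Poly

/-! ## `SU(N)` and `U(N)`: torus and `ℤ^d` -/

section Unitary

open Literature.MathematicalPhysics.QuantumFieldTheory (Edge GaugeConfig wilsonAction wilsonMeasure)
open Literature.MathematicalPhysics.QuantumLattice

variable {d L : ℕ}

/-- The fundamental representation along the exponential subgroup of `SU(N)`: `ρ(e^{tX}) = e^{tX}`. -/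
theorem rho_suExp (N : ℕ) (X : SuGenerator N) (t : ℝ) :
    (fundamentalLatticeRep N).ρ (suExp N X t) = exp ((t : ℂ) • (X : Matrix (Fin N) (Fin N) ℂ)) := by
  change fundamentalRep (Fin N) (suExp N X t) = _
  rw [fundamentalRep_apply, coe_suExp, Complex.coe_smul]

/-- The fundamental representation along the exponential subgroup of `U(N)`: `ρ(e^{tX}) = e^{tX}`. -/
theorem rho_uExp (N : ℕ) (X : UGenerator N) (t : ℝ) :
    (unitaryFundamentalLatticeRep N).ρ (uExp N X t) = exp ((t : ℂ) • (X : Matrix (Fin N) (Fin N) ℂ)) := by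
  change unitaryFundamentalRep (Fin N) ℂ (uExp N X t) = _
  rw [unitaryFundamentalRep_apply, coe_uExp, Complex.coe_smul]

/-- ★★★ **`SU(N)` on the torus `(ℤ/L)^d`, ANY real `β`: a probability measure satisfies the
one-link Schwinger–Dyson identities for all POLYNOMIAL observables (all links, all `X ∈ 𝔰𝔲(N)`) iff
it is Wilson's measure.** [folklore] -/
theorem eq_wilsonMeasure_iff_polySD_suN [NeZero L] (N : ℕ) (β : ℝ)
    (μ : Measure (GaugeConfig d L (Matrix.specialUnitaryGroup (Fin N) ℂ))) [IsProbabilityMeasure μ] :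
    μ = wilsonMeasure (fundamentalRep (Fin N)) β ↔
      IsPolySchwingerDysonState (fundamentalLatticeRep N) (suExp N)
        (fun _ => wilsonAction (fundamentalRep (Fin N))) β μ := by
  rw [eq_wilsonMeasure_iff_sd_suN N β μ]
  exact (isPolySchwingerDysonState_iff (fundamentalLatticeRep N) (continuous_suExp N) (suExp_add N)
    (X := fun X : SuGenerator N => (X : Matrix (Fin N) (Fin N) ℂ))
    (rho_suExp N) (fun g => exists_suExp_eq N g)
    (fun _ => wilsonAction_mem_polyFunctions (fundamentalLatticeRep N))).symm

/-- ★★★ **`U(N)` on the torus, ANY real `β`: polynomial Schwinger–Dyson state ⇔ Wilson's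
measure.** [folklore] -/
theorem eq_wilsonMeasure_iff_polySD_uN [NeZero L] (N : ℕ) (β : ℝ)
    (μ : Measure (GaugeConfig d L (Matrix.unitaryGroup (Fin N) ℂ))) [IsProbabilityMeasure μ] :
    μ = wilsonMeasure (unitaryFundamentalRep (Fin N) ℂ) β ↔
      IsPolySchwingerDysonState (unitaryFundamentalLatticeRep N) (uExp N)
        (fun _ => wilsonAction (unitaryFundamentalRep (Fin N) ℂ)) β μ := by
  rw [eq_wilsonMeasure_iff_sd_uN N β μ]
  exact (isPolySchwingerDysonState_iff (unitaryFundamentalLatticeRep N) (continuous_uExp N) (uExp_add N)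
    (X := fun X : UGenerator N => (X : Matrix (Fin N) (Fin N) ℂ))
    (rho_uExp N) (fun g => exists_uExp_eq N g)
    (fun _ => wilsonAction_mem_polyFunctions (unitaryFundamentalLatticeRep N))).symm

/-- ★★★ **`SU(N)` on `ℤ^d`, ANY real `β`: a probability measure on the gauge configurations
satisfies the one-link Schwinger–Dyson identities for all POLYNOMIAL observables iff it is a DLR
state of the Wilson action.** [folklore] -/
theorem isPolySchwingerDysonState_iff_mem_ymGibbsMeasures_suN (N : ℕ) (β : ℝ)
    (μ : Measure (LGConfig d (Matrix.specialUnitaryGroup (Fin N) ℂ))) [IsProbabilityMeasure μ] :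
    IsPolySchwingerDysonState (fundamentalLatticeRep N) (suExp N)
        (fun e => wilsonBoundaryAction (fundamentalRep (Fin N)) {e}) β μ ↔
      μ ∈ ymGibbsMeasures (fundamentalRep (Fin N)) β := by
  rw [← isSchwingerDysonState_iff_mem_ymGibbsMeasures_suN N β μ]
  exact isPolySchwingerDysonState_iff (fundamentalLatticeRep N) (continuous_suExp N) (suExp_add N)
    (X := fun X : SuGenerator N => (X : Matrix (Fin N) (Fin N) ℂ))
    (rho_suExp N) (fun g => exists_suExp_eq N g)
    (fun e => wilsonBoundaryAction_mem_polyFunctions (fundamentalLatticeRep N) {e})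

/-- ★★★ **`U(N)` on `ℤ^d`, ANY real `β`: polynomial Schwinger–Dyson state (along the exponential shifts `e^{tX}`,
`X ∈ 𝔲(N)`) ⇔ DLR state of the Wilson action.** [folklore] -/
theorem isPolySchwingerDysonState_iff_mem_ymGibbsMeasures_uN (N : ℕ) (β : ℝ)
    (μ : Measure (LGConfig d (Matrix.unitaryGroup (Fin N) ℂ))) [IsProbabilityMeasure μ] :
    IsPolySchwingerDysonState (unitaryFundamentalLatticeRep N) (uExp N)
        (fun e => wilsonBoundaryAction (unitaryFundamentalRep (Fin N) ℂ) {e}) β μ ↔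
      μ ∈ ymGibbsMeasures (unitaryFundamentalRep (Fin N) ℂ) β := by
  rw [← isSchwingerDysonState_iff_mem_ymGibbsMeasures_uN N β μ]
  exact isPolySchwingerDysonState_iff (unitaryFundamentalLatticeRep N) (continuous_uExp N) (uExp_add N)
    (X := fun X : UGenerator N => (X : Matrix (Fin N) (Fin N) ℂ))
    (rho_uExp N) (fun g => exists_uExp_eq N g)
    (fun e => wilsonBoundaryAction_mem_polyFunctions (unitaryFundamentalLatticeRep N) {e})

end Unitary

end Summit.QuantumFields.GaugeBoot

end
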